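import Summits.HubbardSuperconductivity.HubbardSuperconductivity.Theorems.FunctionFieldCertificateWindowInfraredBoundFreeTransferVanishes
import Summits.HubbardSuperconductivity.HubbardSuperconductivity.Theorems.FunctionFieldCertificateWindowInfraredBoundFreeSeaStructure
import Summits.HubbardSuperconductivity.HubbardSuperconductivity.Theorems.FunctionFieldCertificateWindowInfraredBoundFreeTriangleModeSum
import Literature.MathematicalPhysics.QuantumLattice.TorusShellCountUniform

/-!
# Crux `WindowInfraredBound` (stmt-HubbardSuperconductivity-1089) — the free point `U = 0`, file 1/2:
# sharp Fermi seas of ALL free sector ground states, thin shells, and the pair-mode bound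

Calibration R4 of `Cruxes/WindowInfraredBound/STRATEGY-CENSUS.md` §5(iv)/§7 (`FreeWindowBoundAllGroundStates`,
skeleton `Cruxes/WindowInfraredBound/Lines/free_window_calibration.lean`; the four `stub_*` inputs are the sibling
files `…FreeTransferVanishes`, `…FreeSeaStructure`, `…FreeOrthogonalModeSum`, `…FreeTriangleModeSum`). File 2/2
(`…FreeCalibration.lean`) turns this into the flat window law for the crux's functional at `U = 0`.

Basis-free mechanism (no Wick theorem, no trial state, no plane-wave Slater basis):
* `freeGroundStateSeaStructure` (registered) — for EVERY ground state `ψ` of `H₀ = hubbardTorus 2 L 1 0 =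
  Σ ε_L(k) n_{kσ}` in the sector `(N, S^z = M)` (fillings `ν_↑ = N/2 + M`, `ν_↓ = N/2 − M`): `n_{kσ}ψ = ψ` on
  the levels with `#{ε_L ≤ ε_L(k)} ≤ ν_σ` and `n_{kσ}ψ = 0` on those with `ν_σ ≤ #{ε_L < ε_L(k)}`, whatever the
  degeneracy of the open shell (downward transfers `c†_{kσ}c_{k'σ}` are exact lowering eigen-operators of `H₀`
  preserving the sector, so they kill ground states — `stub_freeTransferVanishes`; then counting against the
  filling — `stub_freeSeaStructure`, with the fillings read off `N̂` and `S^z`, `free_sum_momentumNumber_eq`);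
* `free_shell_card_le` — the undecided momenta lie in ONE level set of the band, hence number `≤ 2L`
  (`free_levelSet_card_le`, from `card_torusShell_le_sqrt` at width `0`);
* `free_eucNorm_modeSum_mulVec_le` — for a state with filled momenta `F σ`, empty momenta `E σ` and an
  `↑`-shell of `≤ s` points, and coefficients `|A(k)|² ≤ a`:
  `‖Σ_k A(k) c_{(m−k)↓}c_{k↑} ψ‖ ≤ √a (L + s) ‖ψ‖` (modes through an empty level vanish, modes through a
  filled level are pairwise orthogonal — `stub_freeOrthogonalModeSum` —, shell×shell modes are `≤ s` —
  `stub_freeTriangleModeSum`).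

Sources: J. Bardeen, L. N. Cooper, J. R. Schrieffer, Phys. Rev. 108 (1957) 1175, §II; C. N. Yang,
Rev. Mod. Phys. 34 (1962) 694, §3; E. H. Lieb, M. Loss, *Analysis* (2001) Thm 1.14 (bathtub principle);
E. H. Lieb, PRL 62 (1989) 1201 (sectors). Folklore finite-dimensional statements; no definition and no named
fact is introduced.
-/


noncomputable section

-- the mandated namespace repeats `HubbardSuperconductivity` (single-problem summit, D-0017)
set_option linter.dupNamespace false

namespace Summit.HubbardSuperconductivity.HubbardSuperconductivity.Theorems.WindowInfraredBound

open Matrix Finset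
open Literature.Probability.LatticeModels Literature.MathematicalPhysics.QuantumLattice
open scoped ComplexOrder ComplexConjugate

/-! ## §1 Level sets of the band and the two empty-mode vanishings -/

section Kinematics

variable {L : ℕ} [NeZero L]

/-- **A level set of the square-lattice band has at most `2L` points**: `#{k : ε_L(k) = e} ≤ 2L`
(`card_torusShell_le_sqrt` at width `0`: on each row `cos` takes every value at most twice). [folklore] -/
theorem free_levelSet_card_le (e : ℝ) :
    (((Finset.univ.filter fun k : TorusSite 2 L => torusBand L k = e).card : ℕ) : ℝ) ≤ 2 * L := by
  have h := card_torusShell_le_sqrt (L := L) e 0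
  rw [Real.sqrt_zero, zero_mul, zero_add] at h
  have hsub : (Finset.univ.filter fun k : TorusSite 2 L => torusBand L k = e) ⊆
      (Finset.univ.filter fun k : TorusSite 2 L => |torusBand L k - e| ≤ 0) := by
    intro k hk
    simp only [Finset.mem_filter, Finset.mem_univ, true_and] at hk ⊢
    rw [hk, sub_self, abs_zero]
  exact le_trans (by exact_mod_cast Finset.card_le_card hsub) h

/-- `c_{kσ} ψ = 0` when the mode is empty, `n_{kσ} ψ = 0` (`c n = c`). [folklore] -/
theorem free_momentumAnnihilation_mulVec_eq_zero {k : TorusSite 2 L} {σ : Fin 2}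
    {ψ : Fock (Orb (FermionTorus 2 L))} (h : momentumNumber k σ *ᵥ ψ = 0) :
    momentumAnnihilation k σ *ᵥ ψ = 0 := by
  rw [← momentumAnnihilation_mul_momentumNumber_self, ← mulVec_mulVec, h, mulVec_zero]

/-- The pair mode `B_m(k) = c_{(m−k)↓}c_{k↑}` kills `ψ` if either of its modes is empty in `ψ`. [folklore] -/
theorem free_pairModeAt_mulVec_eq_zero (m k : TorusSite 2 L) {ψ : Fock (Orb (FermionTorus 2 L))}
    (h : momentumNumber k 0 *ᵥ ψ = 0 ∨ momentumNumber (m - k) 1 *ᵥ ψ = 0) :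
    (momentumAnnihilation (m - k) 1 * momentumAnnihilation k 0) *ᵥ ψ = 0 := by
  rcases h with h | h
  · rw [← mulVec_mulVec, free_momentumAnnihilation_mulVec_eq_zero h, mulVec_zero]
  · rw [momentumAnnihilation_mul_eq_neg, neg_mulVec, ← mulVec_mulVec,
      free_momentumAnnihilation_mulVec_eq_zero h, mulVec_zero, neg_zero]

end Kinematics

/-! ## §2 The pair field of a state with a sharp Fermi sea outside a thin shell -/

section ModeBound

variable {L : ℕ} [NeZero L]

/-- **Abstract mode bound.** Let `ψ` have, for each spin, FILLED momenta `F σ` (`n_{kσ}ψ = ψ`) and EMPTY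
momenta `E σ` (`n_{kσ}ψ = 0`) whose common complement (the shell) has at most `s` points for spin `↑`.
Then for coefficients `|A(k)|² ≤ a`:
`‖Σ_k A(k) c_{(m−k)↓}c_{k↑} ψ‖ ≤ √a (L + s) ‖ψ‖` — modes through an empty level vanish
(`free_pairModeAt_mulVec_eq_zero`), modes through a filled level are pairwise orthogonal
(`stub_freeOrthogonalModeSum`, at most `L²` of them), and the shell×shell modes number at most `s`
(`stub_freeTriangleModeSum`). Bardeen–Cooper–Schrieffer (1957) §II. [folklore] -/
theorem free_eucNorm_modeSum_mulVec_le (m : TorusSite 2 L) (A : TorusSite 2 L → ℂ) {a : ℝ} (ha : 0 ≤ a)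
    (hA : ∀ k, ‖A k‖ ^ 2 ≤ a) (F E : Fin 2 → Finset (TorusSite 2 L)) {s : ℝ}
    (ψ : Fock (Orb (FermionTorus 2 L)))
    (hF : ∀ σ, ∀ k ∈ F σ, momentumNumber k σ *ᵥ ψ = ψ)
    (hE : ∀ σ, ∀ k ∈ E σ, momentumNumber k σ *ᵥ ψ = 0)
    (hs : ((((F 0 ∪ E 0)ᶜ).card : ℕ) : ℝ) ≤ s) :
    eucNorm ((∑ k : TorusSite 2 L, A k • (momentumAnnihilation (m - k) 1 * momentumAnnihilation k 0)) *ᵥ ψ) ≤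
      Real.sqrt a * ((L : ℝ) + s) * eucNorm ψ := by
  classical
  set B : TorusSite 2 L → Matrix (Finset (Orb (FermionTorus 2 L))) (Finset (Orb (FermionTorus 2 L))) ℂ :=
    fun k => momentumAnnihilation (m - k) 1 * momentumAnnihilation k 0 with hB
  -- the three classes of momenta
  set pE : TorusSite 2 L → Prop := fun k => k ∈ E 0 ∨ m - k ∈ E 1 with hpE
  set pF : TorusSite 2 L → Prop := fun k => k ∈ F 0 ∨ m - k ∈ F 1 with hpF
  set KE : Finset (TorusSite 2 L) := Finset.univ.filter fun k => pE k with hKE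
  set KF : Finset (TorusSite 2 L) := (Finset.univ.filter fun k => ¬ pE k).filter fun k => pF k with hKF
  set KS : Finset (TorusSite 2 L) := (Finset.univ.filter fun k => ¬ pE k).filter fun k => ¬ pF k with hKS
  -- splitting the sum
  have hsplit : ∑ k : TorusSite 2 L, A k • B k =
      ∑ k ∈ KE, A k • B k + (∑ k ∈ KF, A k • B k + ∑ k ∈ KS, A k • B k) := by
    rw [hKF, hKS, Finset.sum_filter_add_sum_filter_not, hKE, Finset.sum_filter_add_sum_filter_not]
  -- the empty class contributes nothing
  have hE0 : (∑ k ∈ KE, A k • B k) *ᵥ ψ = 0 := by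
    rw [Matrix.sum_mulVec]
    refine Finset.sum_eq_zero fun k hk => ?_
    rw [hKE, Finset.mem_filter] at hk
    rw [smul_mulVec, hB]
    rw [free_pairModeAt_mulVec_eq_zero m k (hk.2.imp (hE 0 k) (hE 1 (m - k))), smul_zero]
  -- the filled class: Pythagoras
  have hF1 : eucNorm ((∑ k ∈ KF, A k • B k) *ᵥ ψ) ≤ Real.sqrt a * L * eucNorm ψ := by
    have h1 := stub_freeOrthogonalModeSum L m A a KF ψ (fun k _ => hA k) (fun k hk => by
      rw [hKF, Finset.mem_filter] at hk
      exact hk.2.imp (hF 0 k) (hF 1 (m - k)))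
    have hcard : (KF.card : ℝ) ≤ (L : ℝ) ^ 2 := by
      have := Finset.card_le_univ KF
      rw [card_torusSite_two] at this
      exact_mod_cast this
    have h2 : eucNorm ((∑ k ∈ KF, A k • B k) *ᵥ ψ) ^ 2 ≤ (Real.sqrt a * L * eucNorm ψ) ^ 2 := by
      rw [eucNorm_sq, mul_pow, mul_pow, Real.sq_sqrt ha, eucNorm_sq]
      refine h1.trans ?_
      have h0 : 0 ≤ (star ψ ⬝ᵥ ψ).re := by rw [← eucNorm_sq]; exact sq_nonneg _
      have : a * KF.card * (star ψ ⬝ᵥ ψ).re ≤ a * (L : ℝ) ^ 2 * (star ψ ⬝ᵥ ψ).re :=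
        mul_le_mul_of_nonneg_right (mul_le_mul_of_nonneg_left hcard ha) h0
      linarith
    exact (pow_le_pow_iff_left₀ (eucNorm_nonneg _)
      (mul_nonneg (mul_nonneg (Real.sqrt_nonneg _) (Nat.cast_nonneg _)) (eucNorm_nonneg _)) two_ne_zero).1 h2
  -- the shell class: at most `s` modes, triangle inequality
  have hS1 : eucNorm ((∑ k ∈ KS, A k • B k) *ᵥ ψ) ≤ Real.sqrt a * s * eucNorm ψ := by
    have h1 := stub_freeTriangleModeSum L m A a KS ψ ha (fun k _ => hA k)
    have hsub : KS ⊆ (F 0 ∪ E 0)ᶜ := by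
      intro k hk
      rw [hKS, Finset.mem_filter, Finset.mem_filter] at hk
      rw [Finset.mem_compl, Finset.mem_union, not_or]
      exact ⟨fun h => hk.2 (Or.inl h), fun h => hk.1.2 (Or.inl h)⟩
    have hcard : (KS.card : ℝ) ≤ s := le_trans (by exact_mod_cast Finset.card_le_card hsub) hs
    refine h1.trans ?_
    have : Real.sqrt a * KS.card * eucNorm ψ ≤ Real.sqrt a * s * eucNorm ψ :=
      mul_le_mul_of_nonneg_right (mul_le_mul_of_nonneg_left hcard (Real.sqrt_nonneg a)) (eucNorm_nonneg ψ)
    exact this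
  -- assemble
  calc eucNorm ((∑ k : TorusSite 2 L, A k • B k) *ᵥ ψ)
      = eucNorm ((∑ k ∈ KF, A k • B k) *ᵥ ψ + (∑ k ∈ KS, A k • B k) *ᵥ ψ) := by
        rw [hsplit, add_mulVec, hE0, zero_add, add_mulVec]
    _ ≤ eucNorm ((∑ k ∈ KF, A k • B k) *ᵥ ψ) + eucNorm ((∑ k ∈ KS, A k • B k) *ᵥ ψ) := eucNorm_add_le _ _
    _ ≤ Real.sqrt a * L * eucNorm ψ + Real.sqrt a * s * eucNorm ψ := add_le_add hF1 hS1
    _ = Real.sqrt a * ((L : ℝ) + s) * eucNorm ψ := by ring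

end ModeBound

/-! ## §3 Free sector ground states: fillings, sharp Fermi seas, thin shells -/

section FermiSea

variable {L : ℕ} [NeZero L]

/-- The spin-resolved particle numbers in momentum space as combinations of the charges:
`Σ_k n_{k↑} = ½ N̂ + S^z`, `Σ_k n_{k↓} = ½ N̂ − S^z` (Parseval per spin, `sum_momentumNumber_eq_sum_numberOp`).
Tasaki (2020) §9.3. [folklore] -/
theorem free_sum_momentumNumber_eq (σ : Fin 2) :
    ∑ k : TorusSite 2 L, momentumNumber k σ =
      (1 / 2 : ℂ) • (totalNumber : Matrix (Finset (Orb (FermionTorus 2 L))) (Finset (Orb (FermionTorus 2 L))) ℂ) +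
        (if σ = 0 then (1 : ℂ) else -1) • HubbardWave0.spinZ := by
  rw [sum_momentumNumber_eq_sum_numberOp, totalNumber_eq_spinWeightedNumber, spinZ_eq_spinWeightedNumber]
  simp only [spinWeightedNumber, Fin.sum_univ_two, Fin.isValue, Matrix.cons_val_zero, Matrix.cons_val_one,
    Finset.smul_sum, ← Finset.sum_add_distrib]
  refine Finset.sum_congr rfl fun x _ => ?_
  fin_cases σ
  · simp only [Fin.zero_eta, Fin.isValue, ↓reduceIte, one_smul, smul_add, smul_smul]
    module
  · simp only [Fin.mk_one, Fin.isValue, one_ne_zero, ↓reduceIte, one_smul, smul_add, smul_smul, neg_smul]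
    module

/-- **Fillings.** On the joint sector `(N, S^z = M)`: `Σ_k n_{k↑} ψ = (N/2 + M) ψ` and
`Σ_k n_{k↓} ψ = (N/2 − M) ψ`. Lieb, PRL 62 (1989) 1201. [folklore] -/
theorem free_sum_momentumNumber_mulVec_of_mem_szSector {N : ℕ} {M : ℝ}
    {ψ : Fock (Orb (FermionTorus 2 L))} (hψ : ψ ∈ szSector N M) (σ : Fin 2) :
    (∑ k : TorusSite 2 L, momentumNumber k σ) *ᵥ ψ =
      (((N : ℝ) / 2 + (if σ = 0 then M else -M) : ℝ) : ℂ) • ψ := by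
  rw [mem_szSector_iff] at hψ
  obtain ⟨hN, hS⟩ := hψ
  replace hN := totalNumber_mulVec_of_isNParticle hN
  rw [free_sum_momentumNumber_eq, add_mulVec, smul_mulVec, smul_mulVec, hN, hS, smul_smul, smul_smul,
    ← add_smul]
  congr 1
  split_ifs <;> push_cast <;> ring

/-- **Sharp Fermi seas of free sector ground states.** For a ground state `ψ` of `hubbardTorus 2 L 1 0`
(`L ≥ 3`) in the sector `(N, S^z = M)` with fillings `ν_↑ = N/2 + M`, `ν_↓ = N/2 − M`: every level `k` with
`#{ε_L ≤ ε_L(k)} ≤ ν_σ` is filled (`n_{kσ}ψ = ψ`) and every level with `ν_σ ≤ #{ε_L < ε_L(k)}` is empty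
(`n_{kσ}ψ = 0`) — whatever the degeneracy of the sector ground space (`stub_freeTransferVanishes` +
`stub_freeSeaStructure`). Lieb–Loss (2001) Thm 1.14. [folklore] -/
theorem free_groundState_seaStructure (hL : 3 ≤ L) {N : ℕ} {M : ℝ} {ψ : Fock (Orb (FermionTorus 2 L))}
    (hψ : IsGroundStateInSector (hubbardTorus 2 L 1 0) N M ψ) (σ : Fin 2) (k : TorusSite 2 L) :
    ((((Finset.univ.filter fun k' : TorusSite 2 L => torusBand L k' ≤ torusBand L k).card : ℕ) : ℝ) ≤
          (N : ℝ) / 2 + (if σ = 0 then M else -M) → momentumNumber k σ *ᵥ ψ = ψ) ∧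
      ((N : ℝ) / 2 + (if σ = 0 then M else -M) ≤
          (((Finset.univ.filter fun k' : TorusSite 2 L => torusBand L k' < torusBand L k).card : ℕ) : ℝ) →
        momentumNumber k σ *ᵥ ψ = 0) :=
  stub_freeSeaStructure L σ (torusBand L) _ ψ (free_sum_momentumNumber_mulVec_of_mem_szSector hψ.1 σ)
    (fun k₁ k₂ h => stub_freeTransferVanishes L hL N M ψ hψ k₁ k₂ σ h) k

/-- **Sharp Fermi seas of ALL free sector ground states (registered form).** For `L ≥ 3`, every
`(N, S^z = M)`, EVERY ground state `ψ` of `hubbardTorus 2 L 1 0` in that sector, each spin `σ` (filling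
`ν_↑ = N/2 + M`, `ν_↓ = N/2 − M`) and each momentum `k`: if `#{ε_L ≤ ε_L(k)} ≤ ν_σ` then `n_{kσ} ψ = ψ`, and if
`ν_σ ≤ #{ε_L < ε_L(k)}` then `n_{kσ} ψ = 0`. The free sector ground space is in general hugely degenerate (open
shells); the statement holds for every vector in it, not only for Slater determinants.
Lieb–Loss (2001) Thm 1.14; Bardeen–Cooper–Schrieffer (1957) §II. [folklore] -/
theorem freeGroundStateSeaStructure : ∀ (L : ℕ) [NeZero L], 3 ≤ L → ∀ (N : ℕ) (M : ℝ)
    (ψ : Fock (Orb (FermionTorus 2 L))), IsGroundStateInSector (hubbardTorus 2 L 1 0) N M ψ →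
    ∀ (σ : Fin 2) (k : TorusSite 2 L),
      (((((Finset.univ.filter fun k' : TorusSite 2 L => torusBand L k' ≤ torusBand L k).card : ℕ) : ℝ) ≤
            (N : ℝ) / 2 + (if σ = 0 then M else -M) → momentumNumber k σ *ᵥ ψ = ψ) ∧
        ((N : ℝ) / 2 + (if σ = 0 then M else -M) ≤
            (((Finset.univ.filter fun k' : TorusSite 2 L => torusBand L k' < torusBand L k).card : ℕ) : ℝ) →
          momentumNumber k σ *ᵥ ψ = 0)) :=
  fun _ _ hL _ _ _ hψ σ k => free_groundState_seaStructure hL hψ σ k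

/-- **The undecided shell lies in one level set, hence has at most `2L` points.** For any filling `ν`:
the momenta that are neither forced-filled (`#{ε ≤ ε_k} ≤ ν`) nor forced-empty (`ν ≤ #{ε < ε_k}`) all have
the same band energy, so there are at most `2L` of them (`free_levelSet_card_le`). [folklore] -/
theorem free_shell_card_le (ν : ℝ) :
    (((Finset.univ.filter fun k : TorusSite 2 L =>
        ¬ ((((Finset.univ.filter fun k' : TorusSite 2 L => torusBand L k' ≤ torusBand L k).card : ℕ) : ℝ) ≤ ν) ∧
        ¬ (ν ≤ (((Finset.univ.filter fun k' : TorusSite 2 L => torusBand L k' < torusBand L k).card : ℕ) : ℝ))).card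
        : ℕ) : ℝ) ≤ 2 * L := by
  classical
  set S := Finset.univ.filter fun k : TorusSite 2 L =>
        ¬ ((((Finset.univ.filter fun k' : TorusSite 2 L => torusBand L k' ≤ torusBand L k).card : ℕ) : ℝ) ≤ ν) ∧
        ¬ (ν ≤ (((Finset.univ.filter fun k' : TorusSite 2 L => torusBand L k' < torusBand L k).card : ℕ) : ℝ))
    with hS
  -- comparison of the two counting functions across a strict level gap
  have hmono : ∀ a b : TorusSite 2 L, torusBand L a < torusBand L b →
      (((Finset.univ.filter fun k' : TorusSite 2 L => torusBand L k' ≤ torusBand L a).card : ℕ) : ℝ) ≤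
        (((Finset.univ.filter fun k' : TorusSite 2 L => torusBand L k' < torusBand L b).card : ℕ) : ℝ) := by
    intro a b hab
    exact_mod_cast Finset.card_le_card (fun k' hk' => by
      simp only [Finset.mem_filter, Finset.mem_univ, true_and] at hk' ⊢
      exact lt_of_le_of_lt hk' hab)
  rcases S.eq_empty_or_nonempty with h0 | ⟨k₀, hk₀⟩
  · rw [h0, Finset.card_empty, Nat.cast_zero]; positivity
  · have hsub : S ⊆ Finset.univ.filter fun k : TorusSite 2 L => torusBand L k = torusBand L k₀ := by
      intro k hk
      rw [hS, Finset.mem_filter] at hk hk₀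
      simp only [Finset.mem_filter, Finset.mem_univ, true_and]
      obtain ⟨_, hk1, hk2⟩ := hk
      obtain ⟨_, hl1, hl2⟩ := hk₀
      push Not at hk1 hk2 hl1 hl2
      by_contra hne
      rcases lt_or_gt_of_ne hne with hlt | hgt
      · have := hmono k k₀ hlt; linarith
      · have := hmono k₀ k hgt; linarith
    exact le_trans (by exact_mod_cast Finset.card_le_card hsub) (free_levelSet_card_le (torusBand L k₀))

end FermiSea

end Summit.HubbardSuperconductivity.HubbardSuperconductivity.Theorems.WindowInfraredBound
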